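import Summits.BirchSwinnertonDyer.Rank1Residual.GaloisImage.SelmerPairCounting
import Summits.BirchSwinnertonDyer.Rank1Residual.GaloisImage.KummerSelfDualCount
import Summits.BirchSwinnertonDyer.Rank1Residual.X11b.KummerStructureDuality
import Literature.NumberTheory.EllipticCurves.WeilPairingProofs
import Literature.NumberTheory.EllipticCurves.SelmerFiniteProofs
import Literature.NumberTheory.GaloisRepresentations.LocalGlobalCohomologyFiniteProofs
import HarnessLib

/-!
# The relaxed-Kummer count: `#H¹_𝓖(K, E[p]) ≥ p^{#T₀}` (Route G budget, level `0`, FILE 4a)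

Cell `b2b-bsdres`, team n1011, seat p10 GEN 4, row **T-E3g-BUD0** (the Route-G budget
`BudgetLeLambdaAt p W b` at level `0`).  This file is the *global counting step*.

Let `K` be a number field, `E/K` an elliptic curve (`W`), `p` an odd prime, `𝓚` the classical
Kummer Selmer structure on `E[p]` (`WeierstrassCurve.kummerSelmerStructure`,
`H¹_𝓚(K, E[p]) = Sel⁽ᵖ⁾(E/K)`), and `T₀` a finite set of finite places `v ∤ p`.  Let `𝓖 ≥ 𝓚`
be the structure obtained from `𝓚` by RELAXING the local condition at `v ∈ T₀` to
`H¹_ur(K_v, E[p]) + 𝓚_v` (unramified classes allowed).  Suppose that at every `v ∈ T₀` the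
relaxation is PROPER: some unramified class `u ∈ H¹_ur(K_v, E[p])` is not a local Kummer class
(this is the "Tamagawa witness", `p ∣ c_v`; supplied by the caller).  Then
`#H¹_𝓖(K, E[p]) ≥ p^{#T₀}`.

Proof (Poitou–Tate pair counting, Wiles / DDT Thm. 2.19, in the tree as
`GaloisImage.card_selmerGroup_pair`):
`#H¹_𝓖 · #H¹_{𝓚*} · ∏_{v∈T} #𝓚_v = #H¹_𝓚 · #H¹_{𝓖*} · ∏_{v∈T} #𝓖_v` for any finite `T ⊇ T₀`
containing the bad places and the places above `p`; the Kummer structure is self-dual in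
cardinality, `#H¹_𝓚 = #H¹_{𝓚*}` (`GaloisImage.natCard_selmerGroup_kummer_eq_dual`, from the Weil
pairing and local Tate duality); `#H¹_{𝓖*} ≥ 1`; and `#𝓖_v ≥ p · #𝓚_v` at `v ∈ T₀` because
`𝓚_v < 𝓖_v` are subgroups of the finite `𝔽_p`-vector space `H¹(K_v, E[p])`
(`mul_card_le_card_of_lt`: a proper subgroup of a finite group killed by `p` has index
divisible by `p`).  Hence `#H¹_𝓖 · ∏ #𝓚_v ≥ p^{#T₀} · ∏ #𝓚_v`.

The output (`exists_addSubgroup_relaxedKummer`) is packaged exactly as the input of FILE 2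
(`exists_finset_torsion_selmerInftyPreimage_zero_card_eq`: a finite subgroup
`S ≤ H¹(K, E[p])` of classes that are Kummer off `T₀` and at `∞`) and FILE 3b
(`layerToInfty_resH1Hom_torsionToPrimaryH1_mem_localKerOver_of_mem_unramified_sup_kummer`:
at `v ∈ T₀` the localisation lies in `H¹_ur + 𝓚_v`).

Inputs that are named facts of the tree (taken as hypotheses, exactly as in
`GaloisImage.card_selmerGroup_pair` / `natCard_selmerGroup_kummer_eq_dual`): a Poitou–Tate family
`inv : LocalInvariants K p` with `IsPerfect`, `SumLocalTermEqZero`, `SelmerComplement`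
(`poitouTate_selmerStructure_duality K`), and the local Euler–Poincaré characteristic formula
`localEulerPoincareCharacteristic (K_v)`.  The Weil pairing (`exists_weilPairing_holds`) and the
finiteness of `Sel⁽ᵖ⁾(E/K)` (`finite_selmerGroup_holds`) are proved in the tree.

References: Wiles 1995 Prop. 1.6 / DDT 1997 Thm. 2.19 (pair counting); Milne, *ADT* I Cor. 2.3,
I Thm. 2.6, I §6; Greenberg, LNM 1716 (1999) §5 pp. 114–118 (the Tamagawa contribution to `λ`).
-/

set_option autoImplicit false

open scoped Classical
open Function NumberField IsDedekindDomain WeierstrassCurve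
open Literature.NumberTheory.EllipticCurves Literature.NumberTheory.GaloisRepresentations
open Literature.NumberTheory.GaloisRepresentations.DiscreteGaloisModule (SelmerStructure unramifiedSubgroup)
open Literature.NumberTheory.GaloisCohomology
open Summit.BirchSwinnertonDyer.Rank1Residual.GaloisImage

universe u

namespace Summit.BirchSwinnertonDyer.Rank1Residual.Additive

/-! ### §1 Subgroups of a finite elementary abelian `p`-group: a proper inclusion costs a factor `p` -/

section PGroup

/-- In a finite abelian group killed by the prime `p` (an `𝔽_p`-vector space), a PROPER inclusion
of subgroups `F < G` forces `p · #F ≤ #G` (dimensions differ by at least one). [folklore] -/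
theorem mul_card_le_card_of_lt {A : Type*} [AddCommGroup A] [Finite A] {p : ℕ} [hp : Fact p.Prime]
    (hA : ∀ a : A, p • a = 0) {F G : AddSubgroup A} (hlt : F < G) :
    p * Nat.card F ≤ Nat.card G := by
  obtain ⟨x, hxG, hxF⟩ := SetLike.exists_of_lt hlt
  have hcardH : Nat.card (F.addSubgroupOf G) = Nat.card F :=
    Nat.card_congr (AddSubgroup.addSubgroupOfEquivOfLe hlt.le).toEquiv
  have hidx : Nat.card (F.addSubgroupOf G) * (F.addSubgroupOf G).index = Nat.card G :=
    (F.addSubgroupOf G).card_mul_index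
  -- the class of `x` in `G ⧸ (F ⊓ G)` is nonzero and killed by `p`, so it has order `p`
  have hq0 : (QuotientAddGroup.mk (⟨x, hxG⟩ : G) : G ⧸ F.addSubgroupOf G) ≠ 0 := fun h ↦
    hxF (AddSubgroup.mem_addSubgroupOf.mp ((QuotientAddGroup.eq_zero_iff _).mp h))
  have hpq : p • (QuotientAddGroup.mk (⟨x, hxG⟩ : G) : G ⧸ F.addSubgroupOf G) = 0 := by
    rw [← QuotientAddGroup.mk_nsmul]
    have hx0 : p • (⟨x, hxG⟩ : G) = 0 := Subtype.ext (hA x)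
    rw [hx0, QuotientAddGroup.mk_zero]
  have hord : addOrderOf (QuotientAddGroup.mk (⟨x, hxG⟩ : G) : G ⧸ F.addSubgroupOf G) = p :=
    ((hp.out.eq_one_or_self_of_dvd _ (addOrderOf_dvd_of_nsmul_eq_zero hpq)).resolve_left
      fun h ↦ hq0 (AddMonoid.addOrderOf_eq_one_iff.mp h))
  have hdvd : p ∣ (F.addSubgroupOf G).index := by
    rw [AddSubgroup.index, ← hord]
    exact addOrderOf_dvd_natCard _
  have hidxpos : 0 < (F.addSubgroupOf G).index :=
    Nat.pos_of_ne_zero AddSubgroup.index_ne_zero_of_finite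
  calc p * Nat.card F = Nat.card (F.addSubgroupOf G) * p := by rw [hcardH, mul_comm]
    _ ≤ Nat.card (F.addSubgroupOf G) * (F.addSubgroupOf G).index :=
        Nat.mul_le_mul_left _ (Nat.le_of_dvd hidxpos hdvd)
    _ = Nat.card G := hidx

end PGroup

/-! ### §2 Torsion classes; local `H¹(K_v, E[p])` is killed by `p` -/

section TopRepTorsion

variable {G : Type u} [Group G] [TopologicalSpace G] [IsTopologicalGroup G] (X : TopRep.{u} ℤ G)

/-- Torsion classes: `n • [φ] = 0` when `n` kills the continuous cocycle `φ` pointwise (any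
topological `ℤ[G]`-module `X`; the tree's `nsmul_oneCocycleClass_eq_zero` is the discrete case).
[folklore] -/
theorem nsmul_oneCocycleClass_eq_zero_of_forall (φ : contOneCocycles X) (n : ℕ)
    (hn : ∀ g, n • φ.1 g = 0) : n • oneCocycleClass X φ = 0 := by
  have h0 : n • φ = 0 := by
    refine Subtype.ext (ContinuousMap.ext fun g ↦ ?_)
    change n • φ.1 g = 0
    exact hn g
  rw [← oneCocycleClassₗ_apply, ← map_nsmul, h0, map_zero]

end TopRepTorsion

section Local

variable {K : Type u} [Field K] (W : WeierstrassCurve K) (p : ℕ)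

/-- Every class of `H¹(K_v, E[p])` (`v` a finite place) is killed by `p`: its cocycles take values
in `E[p]`. [folklore] -/
theorem smul_galoisCohomology_toLocal_torsion_eq_zero [NumberField K] (v : HeightOneSpectrum (𝓞 K))
    (y : galoisCohomology ((W.torsionGaloisModule (p : ℤ)).toLocal (Sum.inr v)) 1) : p • y = 0 := by
  obtain ⟨φ, rfl⟩ := oneCocycleClass_surjective _ y
  refine nsmul_oneCocycleClass_eq_zero_of_forall _ φ p fun g ↦ Subtype.ext ?_
  rw [AddSubgroupClass.coe_nsmul, ZeroMemClass.coe_zero]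
  exact AddSubgroup.torsionBy.nsmul_iff.mp (φ.1 g).2

end Local

/-! ### §3 The count `#H¹_𝓖(K, E[p]) ≥ p^{#T₀}` for a structure `𝓖 ≥ 𝓚` -/

section Count

variable {K : Type u} [Field K] [NumberField K] (W : WeierstrassCurve K) [W.IsElliptic] (p : ℕ)
  [hp : Fact p.Prime]

/-- **Pair counting against the Kummer structure.** Let `p` be an odd prime, `𝓚` the Kummer Selmer
structure on `E[p]` and `𝓖 ≥ 𝓚` a Selmer structure agreeing with `𝓚` at the infinite places, both
unramified outside `S(T)` for a finite set `T` of finite places off which `p ∤ v` and `E[p]` is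
unramified.  If `#𝓖_v ≥ p · #𝓚_v` at every `v ∈ T₀ ⊆ T`, then `H¹_𝓖(K, E[p])` is finite and
`#H¹_𝓖(K, E[p]) ≥ p^{#T₀}`.  From `GaloisImage.card_selmerGroup_pair` (Wiles / DDT Thm. 2.19:
`#H¹_𝓖 · #H¹_{𝓚*} · ∏_T #𝓚_v = #H¹_𝓚 · #H¹_{𝓖*} · ∏_T #𝓖_v`), the self-duality count
`#H¹_𝓚 = #H¹_{𝓚*}` (`GaloisImage.natCard_selmerGroup_kummer_eq_dual`, Weil pairing), `#H¹_{𝓖*} ≥ 1`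
and `∏_T #𝓖_v ≥ p^{#T₀} ∏_T #𝓚_v`.  The Poitou–Tate family `inv` and the local Euler–Poincaré
formula are hypotheses (named facts of the tree). [folklore] -/
theorem finite_and_pow_le_card_selmerGroup_of_kummer_le (hodd : p ≠ 2)
    (inv : LocalInvariants K p) (hperf : inv.IsPerfect) (hsum : inv.SumLocalTermEqZero)
    (hcompl : inv.SelmerComplement)
    (hEP : ∀ v : HeightOneSpectrum (𝓞 K), localEulerPoincareCharacteristic (v.adicCompletion K))
    (T : Finset (HeightOneSpectrum (𝓞 K)))
    (hS : ∀ v ∉ T, ((p : ℕ) : 𝓞 K) ∉ v.asIdeal ∧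
      GaloisRep.IsUnramifiedAt v (W.torsionGaloisModule (p : ℤ)))
    (h𝓚 : (W.kummerSelmerStructure (p : ℤ)).IsUnramifiedOutside (finSupport T))
    {𝓖 : SelmerStructure (W.torsionGaloisModule (p : ℤ))} (hle : W.kummerSelmerStructure (p : ℤ) ≤ 𝓖)
    (h𝓖 : 𝓖.IsUnramifiedOutside (finSupport T))
    (hinf : ∀ w : InfinitePlace K, W.kummerSelmerStructure (p : ℤ) (Sum.inl w) = 𝓖 (Sum.inl w))
    (T₀ : Finset (HeightOneSpectrum (𝓞 K))) (hT₀ : T₀ ⊆ T)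
    (hbig : ∀ v ∈ T₀, p * Nat.card (W.kummerSelmerStructure (p : ℤ) (Sum.inr v)) ≤
      Nat.card (𝓖 (Sum.inr v))) :
    Finite 𝓖.selmerGroup ∧ p ^ T₀.card ≤ Nat.card 𝓖.selmerGroup := by
  haveI : NeZero p := ⟨hp.out.ne_zero⟩
  haveI : Finite (geomTorsion W (p : ℤ)) := finite_geomTorsion_of_neZero W p
  -- `Sel⁽ᵖ⁾(E/K) = H¹_𝓚(K, E[p])` is finite
  haveI hfinK : Finite (W.kummerSelmerStructure (p : ℤ)).selmerGroup := by
    rw [← selmerGroup_eq_selmerGroup_kummerSelmerStructure]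
    exact finite_selmerGroup_holds W (by exact_mod_cast hp.out.ne_zero)
  -- the Weil pairing and the self-duality count `#H¹_𝓚 = #H¹_{𝓚*}`
  obtain ⟨e, hμ, hadd₁, hadd₂, halt, hnondeg, hgal⟩ :=
    exists_weilPairing_holds W p hp.out.two_le (Nat.cast_ne_zero.mpr hp.out.ne_zero)
  have hinv : ∀ v : HeightOneSpectrum (𝓞 K), Injective (inv (Sum.inr v)) :=
    fun v ↦ (hperf v).1.injective
  have hself := natCard_selmerGroup_kummer_eq_dual W p e hμ hadd₁ hadd₂ hgal halt hnondeg
    hp.out.isPrimePow (hp.out.odd_of_ne_two hodd) inv hinv hEP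
  -- pair counting
  have hM : ∀ m : geomTorsion W (p : ℤ), p • m = 0 := fun m ↦ Subtype.ext <| by
    rw [AddSubgroupClass.coe_nsmul, ZeroMemClass.coe_zero]
    exact AddSubgroup.torsionBy.nsmul_iff.mp m.2
  have hpair := card_selmerGroup_pair (W.torsionGaloisModule (p : ℤ)) T inv hperf hsum hcompl
    hM hS hle h𝓚 h𝓖 hinf
  rw [← hself] at hpair
  -- positivity of the factors
  have ha : 0 < Nat.card (W.kummerSelmerStructure (p : ℤ)).selmerGroup := Nat.card_pos
  haveI : Finite (inv.dualSelmerStructure (W.torsionGaloisModule (p : ℤ))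
      (W.kummerSelmerStructure (p : ℤ))).selmerGroup :=
    Nat.finite_of_card_ne_zero (hself ▸ ha.ne')
  haveI : Finite (inv.dualSelmerStructure (W.torsionGaloisModule (p : ℤ)) 𝓖).selmerGroup :=
    Finite.of_injective _ (AddSubgroup.inclusion_injective
      (LocalInvariants.selmerGroup_dualSelmerStructure_anti inv (W.torsionGaloisModule (p : ℤ)) hle))
  have hGd : 0 < Nat.card (inv.dualSelmerStructure (W.torsionGaloisModule (p : ℤ)) 𝓖).selmerGroup :=
    Nat.card_pos
  have hlocfin : ∀ v : HeightOneSpectrum (𝓞 K),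
      Finite (galoisCohomology ((W.torsionGaloisModule (p : ℤ)).toLocal (Sum.inr v)) 1) :=
    fun v ↦ finite_galoisCohomology_one_toLocal _ v
  have hPK : 0 < ∏ v ∈ T, Nat.card (W.kummerSelmerStructure (p : ℤ) (Sum.inr v)) := by
    refine Finset.prod_pos fun v _ ↦ ?_
    haveI := hlocfin v
    exact Nat.card_pos
  -- `∏_T #𝓖_v ≥ p^{#T₀} · ∏_T #𝓚_v`
  have hprod : p ^ T₀.card * ∏ v ∈ T, Nat.card (W.kummerSelmerStructure (p : ℤ) (Sum.inr v)) ≤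
      ∏ v ∈ T, Nat.card (𝓖 (Sum.inr v)) := by
    have hc : ∏ v ∈ T, (if v ∈ T₀ then p else 1) = p ^ T₀.card := by
      rw [Finset.prod_ite_mem, Finset.inter_eq_right.mpr hT₀, Finset.prod_const]
    rw [← hc, ← Finset.prod_mul_distrib]
    refine Finset.prod_le_prod (fun v _ ↦ Nat.zero_le _) fun v _ ↦ ?_
    haveI := hlocfin v
    split_ifs with hv
    · exact hbig v hv
    · rw [one_mul]
      exact AddSubgroup.card_le_of_le (hle (Sum.inr v))
  -- conclude
  have hkey : p ^ T₀.card * ∏ v ∈ T, Nat.card (W.kummerSelmerStructure (p : ℤ) (Sum.inr v)) ≤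
      Nat.card 𝓖.selmerGroup *
        ∏ v ∈ T, Nat.card (W.kummerSelmerStructure (p : ℤ) (Sum.inr v)) := by
    have h1 : Nat.card 𝓖.selmerGroup *
        ∏ v ∈ T, Nat.card (W.kummerSelmerStructure (p : ℤ) (Sum.inr v)) =
        Nat.card (inv.dualSelmerStructure (W.torsionGaloisModule (p : ℤ)) 𝓖).selmerGroup *
          ∏ v ∈ T, Nat.card (𝓖 (Sum.inr v)) := by
      refine Nat.eq_of_mul_eq_mul_left ha ?_
      calc Nat.card (W.kummerSelmerStructure (p : ℤ)).selmerGroup * (Nat.card 𝓖.selmerGroup *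
              ∏ v ∈ T, Nat.card (W.kummerSelmerStructure (p : ℤ) (Sum.inr v)))
          = Nat.card 𝓖.selmerGroup * Nat.card (W.kummerSelmerStructure (p : ℤ)).selmerGroup *
              ∏ v ∈ T, Nat.card (W.kummerSelmerStructure (p : ℤ) (Sum.inr v)) := by ring
        _ = _ := hpair
        _ = _ := by ring
    rw [h1]
    calc p ^ T₀.card * ∏ v ∈ T, Nat.card (W.kummerSelmerStructure (p : ℤ) (Sum.inr v))
        ≤ ∏ v ∈ T, Nat.card (𝓖 (Sum.inr v)) := hprod
      _ ≤ _ := Nat.le_mul_of_pos_left _ hGd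
  have hG : p ^ T₀.card ≤ Nat.card 𝓖.selmerGroup := Nat.le_of_mul_le_mul_right hkey hPK
  exact ⟨Nat.finite_of_card_ne_zero (Nat.pos_iff_ne_zero.mp
    (lt_of_lt_of_le (pow_pos hp.out.pos _) hG)), hG⟩

end Count

/-! ### §4 The relaxed Kummer structure and its Selmer group -/

section Relaxed

variable {K : Type} [Field K] [NumberField K] (W : WeierstrassCurve K) [W.IsElliptic] (p : ℕ)
  [hp : Fact p.Prime]

/-- **The relaxed-Kummer count, packaged for the level-`0` budget.** Let `p` be an odd prime and
`T₀` a finite set of finite places of `K` carrying *Tamagawa witnesses*: at each `v ∈ T₀` some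
unramified class of `H¹(K_v, E[p])` is not a local Kummer class.  Then there is a FINITE subgroup
`S ≤ H¹(K, E[p])` with `#S ≥ p^{#T₀}` all of whose classes are local Kummer classes at every finite
place off `T₀` and at every infinite place, and lie in `H¹_ur(K_v, E[p]) + 𝓚_v` at `v ∈ T₀`
(namely `S = H¹_𝓖(K, E[p])` for the Kummer structure relaxed by the unramified classes on `T₀`).
These are exactly the hypotheses of `exists_finset_torsion_selmerInftyPreimage_zero_card_eq`
(FILE 2) and `layerToInfty_resH1Hom_torsionToPrimaryH1_mem_localKerOver_of_mem_unramified_sup_kummer`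
(FILE 3b).  Hypotheses: a Poitou–Tate family (`poitouTate_selmerStructure_duality K p`) and the
local Euler–Poincaré formula, as in §3. [folklore] -/
theorem exists_addSubgroup_relaxedKummer (hodd : p ≠ 2)
    (inv : LocalInvariants K p) (hperf : inv.IsPerfect) (hsum : inv.SumLocalTermEqZero)
    (hcompl : inv.SelmerComplement)
    (hEP : ∀ v : HeightOneSpectrum (𝓞 K), localEulerPoincareCharacteristic (v.adicCompletion K))
    (T₀ : Finset (HeightOneSpectrum (𝓞 K)))
    (hwit : ∀ v ∈ T₀, ∃ u ∈ unramifiedSubgroup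
        ((W.torsionGaloisModule (p : ℤ)).restrictField (v.adicCompletion K)) 1,
      u ∉ W.kummerLocalConditionAt (p : ℤ) (v.adicCompletion K)) :
    ∃ S : AddSubgroup (galH1Torsion W (p : ℤ)), Finite S ∧ p ^ T₀.card ≤ Nat.card S ∧
      ∀ y ∈ S,
        (∀ v ∉ (↑T₀ : Set (HeightOneSpectrum (𝓞 K))),
            y ∈ selmerLocalKer W (v.adicCompletion K) (p : ℤ)) ∧
        (∀ w : InfinitePlace K, y ∈ selmerLocalKer W w.Completion (p : ℤ)) ∧
        ∀ v ∈ T₀, galoisCohomology.res (W.torsionGaloisModule (p : ℤ)) (v.adicCompletion K) 1 y ∈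
          unramifiedSubgroup ((W.torsionGaloisModule (p : ℤ)).restrictField (v.adicCompletion K)) 1 ⊔
            W.kummerLocalConditionAt (p : ℤ) (v.adicCompletion K) := by
  haveI : NeZero p := ⟨hp.out.ne_zero⟩
  haveI : Finite (geomTorsion W (p : ℤ)) := finite_geomTorsion_of_neZero W p
  -- a finite set `T ⊇ T₀ ∪ {bad} ∪ {v ∣ p}` of finite places
  have hbadfin : {v : HeightOneSpectrum (𝓞 K) | ¬ W.HasGoodReductionAt v}.Finite := by
    have h := W.eventually_hasGoodReductionAt
    rwa [Filter.eventually_cofinite] at h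
  have hp0 : (Ideal.span {((p : ℕ) : 𝓞 K)} : Ideal (𝓞 K)) ≠ 0 := by
    rw [Ne, Ideal.zero_eq_bot, Ideal.span_singleton_eq_bot]
    exact_mod_cast hp.out.ne_zero
  have hpfin : {v : HeightOneSpectrum (𝓞 K) | ((p : ℕ) : 𝓞 K) ∈ v.asIdeal}.Finite := by
    refine (Ideal.finite_factors hp0).subset fun v hv ↦ ?_
    exact (Ideal.dvd_span_singleton).mpr hv
  obtain ⟨T, hT₀T, hTp, hTbad⟩ : ∃ T : Finset (HeightOneSpectrum (𝓞 K)), T₀ ⊆ T ∧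
      (∀ v, ((p : ℕ) : 𝓞 K) ∈ v.asIdeal → v ∈ T) ∧ ∀ v, ¬ W.HasGoodReductionAt v → v ∈ T :=
    ⟨T₀ ∪ (hbadfin.toFinset ∪ hpfin.toFinset), Finset.subset_union_left,
      fun v hv ↦ Finset.mem_union_right _ (Finset.mem_union_right _ (hpfin.mem_toFinset.mpr hv)),
      fun v hv ↦ Finset.mem_union_right _ (Finset.mem_union_left _ (hbadfin.mem_toFinset.mpr hv))⟩
  have hS : ∀ v ∉ T, ((p : ℕ) : 𝓞 K) ∉ v.asIdeal ∧
      GaloisRep.IsUnramifiedAt v (W.torsionGaloisModule (p : ℤ)) := fun v hv ↦ by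
    have hpv : ((p : ℕ) : 𝓞 K) ∉ v.asIdeal := fun h ↦ hv (hTp v h)
    have hgood : W.HasGoodReductionAt v := by_contra fun h ↦ hv (hTbad v h)
    exact ⟨hpv, X11b.AcSelmer.isUnramifiedAt_torsionGaloisModule W hgood
      (by rw [Int.cast_natCast]; exact hpv)⟩
  have hfs_p : ∀ v : HeightOneSpectrum (𝓞 K), ((p : ℕ) : 𝓞 K) ∈ v.asIdeal →
      (Sum.inr v : Place K) ∈ finSupport T := fun v hv ↦ (inr_mem_finSupport_iff T v).mpr (hTp v hv)
  have hfs_bad : ∀ v : HeightOneSpectrum (𝓞 K), ¬ W.HasGoodReductionAt v →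
      (Sum.inr v : Place K) ∈ finSupport T := fun v hv ↦ (inr_mem_finSupport_iff T v).mpr (hTbad v hv)
  have h𝓚 : (W.kummerSelmerStructure (p : ℤ)).IsUnramifiedOutside (finSupport T) := by
    have h1 := X11b.KummerDuality.kummerSelmerStructure_isUnramifiedOutside W p 1
      (finSupport T) (inl_mem_finSupport T) hfs_p hfs_bad
    rwa [pow_one] at h1
  -- the relaxed structure `𝓖`: `H¹_ur + 𝓚_v` on `T₀`, `𝓚_v` elsewhere
  obtain ⟨𝓖, h𝓖inl, h𝓖T₀, h𝓖off⟩ : ∃ 𝓖 : SelmerStructure (W.torsionGaloisModule (p : ℤ)),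
      (∀ w : InfinitePlace K, 𝓖 (Sum.inl w) = W.kummerSelmerStructure (p : ℤ) (Sum.inl w)) ∧
      (∀ v ∈ T₀, 𝓖 (Sum.inr v) =
        unramifiedSubgroup (GaloisRep.toLocal v (W.torsionGaloisModule (p : ℤ))) 1 ⊔
          W.kummerSelmerStructure (p : ℤ) (Sum.inr v)) ∧
      (∀ v ∉ T₀, 𝓖 (Sum.inr v) = W.kummerSelmerStructure (p : ℤ) (Sum.inr v)) :=
    ⟨fun w ↦ match w with
      | Sum.inl w => W.kummerSelmerStructure (p : ℤ) (Sum.inl w)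
      | Sum.inr v => if v ∈ T₀ then
          unramifiedSubgroup (GaloisRep.toLocal v (W.torsionGaloisModule (p : ℤ))) 1 ⊔
            W.kummerSelmerStructure (p : ℤ) (Sum.inr v)
        else W.kummerSelmerStructure (p : ℤ) (Sum.inr v),
      fun _ ↦ rfl, fun v hv ↦ if_pos hv, fun v hv ↦ if_neg hv⟩
  have hle : W.kummerSelmerStructure (p : ℤ) ≤ 𝓖 := by
    rintro (w | v)
    · rw [h𝓖inl w]
    · by_cases hv : v ∈ T₀
      · rw [h𝓖T₀ v hv]; exact le_sup_right
      · rw [h𝓖off v hv]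
  have h𝓖ur : 𝓖.IsUnramifiedOutside (finSupport T) := by
    refine ⟨inl_mem_finSupport T, fun v hv ↦ ?_⟩
    have hvT : v ∉ T := fun h ↦ hv ((inr_mem_finSupport_iff T v).mpr h)
    rw [h𝓖off v fun h ↦ hvT (hT₀T h)]
    exact h𝓚.2 v hv
  have hbig : ∀ v ∈ T₀, p * Nat.card (W.kummerSelmerStructure (p : ℤ) (Sum.inr v)) ≤
      Nat.card (𝓖 (Sum.inr v)) := fun v hv ↦ by
    haveI := finite_galoisCohomology_one_toLocal (W.torsionGaloisModule (p : ℤ)) v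
    obtain ⟨u, hu, huK⟩ := hwit v hv
    refine mul_card_le_card_of_lt (smul_galoisCohomology_toLocal_torsion_eq_zero W p v) ?_
    rw [h𝓖T₀ v hv]
    exact right_lt_sup.mpr fun h ↦ huK (h hu)
  obtain ⟨hfin, hcard⟩ := finite_and_pow_le_card_selmerGroup_of_kummer_le W p hodd inv hperf hsum
    hcompl hEP T hS h𝓚 hle h𝓖ur (fun w ↦ (h𝓖inl w).symm) T₀ hT₀T hbig
  refine ⟨𝓖.selmerGroup, hfin, hcard, fun y hy ↦ ⟨fun v hv ↦ ?_, fun w ↦ ?_, fun v hv ↦ ?_⟩⟩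
  · have h := (𝓖.mem_selmerGroup_iff y).mp hy (Sum.inr v)
    rw [h𝓖off v hv] at h
    have h' : y ∈ (W.kummerSelmerStructure (p : ℤ) (Sum.inr v)).comap
        (galoisCohomology.localization (W.torsionGaloisModule (p : ℤ)) (Sum.inr v) 1) := h
    rw [comap_localization_kummerSelmerStructure] at h'
    exact h'
  · have h := (𝓖.mem_selmerGroup_iff y).mp hy (Sum.inl w)
    rw [h𝓖inl w] at h
    have h' : y ∈ (W.kummerSelmerStructure (p : ℤ) (Sum.inl w)).comap
        (galoisCohomology.localization (W.torsionGaloisModule (p : ℤ)) (Sum.inl w) 1) := h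
    rw [comap_localization_kummerSelmerStructure] at h'
    exact h'
  · have h := (𝓖.mem_selmerGroup_iff y).mp hy (Sum.inr v)
    rw [h𝓖T₀ v hv] at h
    exact h

end Relaxed

end Summit.BirchSwinnertonDyer.Rank1Residual.Additive
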